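import Summits.BirchSwinnertonDyer.BirchSwinnertonDyer.Theses.PrintX10b
import Summits.BirchSwinnertonDyer.Rank1Residual.X10.AnalyticMuZeroThreeRhoBarInvariance
import Literature.NumberTheory.EllipticCurves.SkinnerUrban2014.PAdicUnitPeriodRatioProofs
import HarnessLib

/-!
# Route PrintX10b, crux `AnalyticMuZeroX10b` (stmt-BirchSwinnertonDyer-20682): the congruence road at
# `p = 3`, class-wide — the crux is EQUIVALENT to «every X10b pair has a `μ`-certified good-ordinary
# `3`-congruent partner», and the planner's line `epw-partner` composes in the kernel

Cell `bsd-print-x9` (D-0131 (2) print tier), seat p2 («`μ = 0` by congruence transport (Greenberg–Vatsal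
2000 (1.4) / Emerton–Pollack–Weston 2006 Thm. 1) + analytic `μ = 0` certificate»), gen 2. HONEST FRAMING:
theorems only (no definition, no new named fact); nothing is booked; the file is a CONDITIONAL helper of
crux 20682 (`--supports`), not a closer. It is the `p = 3` twin of the K6 record
`Theorems/SmallImageMuTransferAnalyticMuZeroX9CertifiedPartner` (p533399) and the Theorems-side form of
the planner's BC3 birth skeleton `Cruxes/AnalyticMuZeroX10b/Lines/birth.lean` (line `epw-partner`:
`stub_certifiedPartner` + `stub_transferPrint` ⇒ crux), with the print stub DISCHARGED down to three
cite-only heads of the route's own cone.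

## What is proved

Write X10b for the class of the route (`ClassX10 W p ∧ ¬ Surj W 3`: `p = 3` good ordinary, `E[3]`
irreducible, mod-`3` image a Cartan normaliser, analytic rank `≤ 1` in the class's shape) and call a
**certified partner** of an X10b pair `(W, 3)` a globally minimal elliptic `W'/ℚ`, good ordinary at `3`,
with a `Γ_ℚ`-equivariant `W'[3] ≃ W[3]` and a newform `f'` of `W'` (any level) ONE of whose
`L_3(f', α_{W'})`-coefficients is a `3`-adic unit (`W' = W` allowed; irreducibility of `W'[3]` is
automatic, transported from `W[3]`).

* `printX10b_analyticMuZeroX10b_of_forall_exists_certifiedPartner` — granting Emerton–Pollack–Weston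
  Thm. 1 at odd `p` (`hEPW`), Mazur's odd Manin constant (`hM`, route aside 19383, which yields the
  period unit `Ω_W = u·Ω⁺_f`, `‖u‖_3 = 1`, by `realPeriodRat_eq_unit_mul_plusPeriod_three_of_mazur`)
  and Carayol (`hlev`): IF every X10b pair has a certified partner THEN the crux
  `Theses.PrintX10b.AnalyticMuZeroX10b` (kernel: `X10.certificate_of_torsionIso_of_ne_two'`).
* `printX10b_forall_exists_certifiedPartner_of_analyticMuZeroX10b` — conversely (modularity `hmodP`,
  route aside 19266) the crux makes every X10b pair its own certified partner.
* `printX10b_analyticMuZeroX10b_iff_forall_exists_certifiedPartner` — **the congruence road, class-wide,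
  is EXACTLY the crux**: it re-indexes Greenberg's analytic `μ = 0` at `3` by mod-`3` representation (one
  certificate per `ρ̄`, transported by EPW along `H(ρ̄)`) and cannot weaken it — the residual crux of
  the line is 20682 itself, now in the shape «a `ρ̄` of the class with NO certifiable ordinary partner».
* `printX10b_analyticMuZeroX10b_of_stubs` — the birth skeleton's composition with the skeleton's exact
  stub signatures (`stub_certifiedPartner`, `stub_transferPrint`), so the line `epw-partner` closes the
  crux modulo its one open stub in the Theorems tree as well.
* `printX10b_transferPrint_of_mazur` — the skeleton's print stub `stub_transferPrint` (EPW odd ∧ period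
  units at `p ≥ 5` and at `3` ∧ Carayol) from `hEPW`, `hM`, `hlev` alone (both period units are Mazur
  1978 Cor. 4.1 over the tree, `SkinnerUrban2014/PAdicUnitPeriodRatioProofs`).

What this is NOT: not a proof of any `μ = 0`; the class has infinitely many mod-`3` representations
(genus-0 families 3Ns/3Nn), so finitely many certificates never close the class statement; the 313
census cells (x10 GEN 36, three engines) each delete the crux on the infinite congruence class they
represent, nothing more. beyond-print theorem: no (bookkeeping over EPW). Evidence of record for the
crux: `class-closure/N2/MUCERT3-x10g36.tsv` (313/313 cells, `μ_an(3) = 0`, three engines, 0 alarms).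

References: [EmertonPollackWeston2006] Thm. 1 (arXiv:math/0404484 p. 2), §1 Notation (p. 5), §2.6;
[GreenbergVatsal2000] §3 Rem. (3.4), Prop. (3.7); [Mazur1978] Cor. 4.1; [GreenbergLNM1716] §1 Conj. 1.11;
[Carayol1986]; [BCDTJAMS2001] Thm. A.
-/

set_option autoImplicit false

noncomputable section

open scoped Classical MatrixGroups ModularForm

open CongruenceSubgroup WeierstrassCurve Field
open Literature.NumberTheory.EllipticCurves Literature.NumberTheory.EllipticCurves.ModularForms
  Literature.NumberTheory.EllipticCurves.Rank1Residual
open Summit.BirchSwinnertonDyer.BirchSwinnertonDyer.Theses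

namespace Summit.BirchSwinnertonDyer.Rank1Residual.X10

/-! ### §1 The print stub of the line, discharged to three cite-only heads -/

/-- **The line's print bundle from Mazur's odd Manin constant.** EPW Thm. 1 at odd `p` (`hEPW`) ∧ the
period unit at good `p ≥ 5` ∧ the period unit at good `p = 3` ∧ Carayol's `N = N_E` — the exact
signature of the birth skeleton's `stub_transferPrint` — where BOTH period units are theorems over the
tree from Mazur 1978 Cor. 4.1 (`hM` = route aside 19383 `MazurManinConstantOdd`).
[cite: Mazur1978, Cor. 4.1] [cite: GreenbergVatsal2000, §3, Remark 3.4]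
[cite: EmertonPollackWeston2006, Thm. 1 (arXiv:math/0404484 p. 2)] -/
theorem printX10b_transferPrint_of_mazur
    (hEPW : EmertonPollackWeston2006.thm1_muAn_transfer_of_torsionIso_odd)
    (hM : mazur_not_dvd_maninConstant_of_odd)
    (hlev : ∀ (N : ℕ) [NeZero N], IsNewformOf.level_eq_conductorNorm (N := N)) :
    EmertonPollackWeston2006.thm1_muAn_transfer_of_torsionIso_odd ∧
    realPeriodRat_eq_unit_mul_plusPeriod ∧ realPeriodRat_eq_unit_mul_plusPeriod_three ∧
    (∀ (N : ℕ) [NeZero N], IsNewformOf.level_eq_conductorNorm (N := N)) :=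
  ⟨hEPW, SkinnerUrban2014.realPeriodRat_eq_unit_mul_plusPeriod_of_mazur hM,
    SkinnerUrban2014.realPeriodRat_eq_unit_mul_plusPeriod_three_of_mazur hM, fun N _ => hlev N⟩

/-! ### §2 Crux ⟸ certified partners (the load-bearing direction of the line) -/

/-- **Crux `AnalyticMuZeroX10b` BY NAME from certified partners.** Granting EPW Thm. 1 at odd `p`
(`hEPW`), Mazur's odd Manin constant (`hM`) and Carayol (`hlev`): IF every X10b pair `(W, p)` (so
`p = 3`) has a globally minimal partner `W'`, good ordinary at `p`, with a `Γ_ℚ`-equivariant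
`W'[p] ≃ W[p]` and a newform `f'` of `W'` of some level carrying ONE `p`-adic unit coefficient of
`L_p(f', α_{W'})` (`W' = W` allowed, anomalous allowed, any coefficient index), THEN
`Theses.PrintX10b.AnalyticMuZeroX10b`. Proof: `W'[3]` is irreducible (transported from `W[3]`) and
`certificate_of_torsionIso_of_ne_two'` (x10 GEN 37) moves the certificate to every newform of `W`.
[cite: EmertonPollackWeston2006, Thm. 1 (arXiv:math/0404484 p. 2)] [cite: Mazur1978, Cor. 4.1]
[cite: GreenbergVatsal2000, §3 Remark (3.4)] -/
theorem printX10b_analyticMuZeroX10b_of_forall_exists_certifiedPartner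
    (hEPW : EmertonPollackWeston2006.thm1_muAn_transfer_of_torsionIso_odd)
    (hM : mazur_not_dvd_maninConstant_of_odd)
    (hlev : ∀ (N : ℕ) [NeZero N], IsNewformOf.level_eq_conductorNorm (N := N))
    (hpartner : ∀ (W : WeierstrassCurve ℚ) [W.IsElliptic] [W.IsGloballyMinimal] (p : ℕ) [Fact p.Prime],
      ClassX10 W p → ¬ Surj W 3 →
      ∃ (W' : WeierstrassCurve ℚ) (_ : W'.IsElliptic) (_ : W'.IsGloballyMinimal),
        W'.HasGoodReductionAtPrime p ∧ ¬ (p : ℤ) ∣ W'.frobeniusTrace p ∧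
        (∃ e : geomTorsion W' (p : ℤ) ≃+ geomTorsion W (p : ℤ),
          ∀ (σ : Field.absoluteGaloisGroup ℚ) (P : geomTorsion W' (p : ℤ)), e (σ • P) = σ • e P) ∧
        ∃ (N' : ℕ) (_ : NeZero N') (f' : CuspForm (Gamma0 N') 2), IsNewformOf W' f' ∧
          ∃ n : ℕ, ‖PowerSeries.coeff n (padicLFunction f' (unitRoot W' p : ℚ_[p]))‖ = 1) :
    PrintX10b.AnalyticMuZeroX10b := by
  unfold PrintX10b.AnalyticMuZeroX10b AnalyticMuZeroOnClassX10b
  intro W _ _ p _ N _ f hX hns hf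
  obtain ⟨W', _, _, hgood', hord', ⟨e, he⟩, N', _, f', hf', hcert'⟩ := hpartner W p hX hns
  obtain ⟨hp3, ⟨hgood, hord⟩, hirr, -⟩ := hX
  subst hp3
  have hirr' : W'.HasIrreducibleModPGaloisRep 3 := hasIrreducibleModPGaloisRep_of_torsionIso_symm e he hirr
  exact certificate_of_torsionIso_of_ne_two' hEPW
    (SkinnerUrban2014.realPeriodRat_eq_unit_mul_plusPeriod_of_mazur hM)
    (SkinnerUrban2014.realPeriodRat_eq_unit_mul_plusPeriod_three_of_mazur hM) hlev W' W 3 (by decide)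
    hgood' hord' hirr' hgood hord ⟨e, he⟩ f' hf' f hf hcert'

/-! ### §3 Crux ⟹ certified partners (the pair itself), and the equivalence -/

/-- **Conversely, the crux supplies a certified partner for every X10b pair — the pair itself** (at the
newform given by modularity, `hmodP` = route aside 19266). [cite: BCDTJAMS2001, Thm. A] -/
theorem printX10b_forall_exists_certifiedPartner_of_analyticMuZeroX10b
    (hmodP : nonempty_modularParametrizationData) (hA : PrintX10b.AnalyticMuZeroX10b) :
    ∀ (W : WeierstrassCurve ℚ) [W.IsElliptic] [W.IsGloballyMinimal] (p : ℕ) [Fact p.Prime],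
      ClassX10 W p → ¬ Surj W 3 →
      ∃ (W' : WeierstrassCurve ℚ) (_ : W'.IsElliptic) (_ : W'.IsGloballyMinimal),
        W'.HasGoodReductionAtPrime p ∧ ¬ (p : ℤ) ∣ W'.frobeniusTrace p ∧
        (∃ e : geomTorsion W' (p : ℤ) ≃+ geomTorsion W (p : ℤ),
          ∀ (σ : Field.absoluteGaloisGroup ℚ) (P : geomTorsion W' (p : ℤ)), e (σ • P) = σ • e P) ∧
        ∃ (N' : ℕ) (_ : NeZero N') (f' : CuspForm (Gamma0 N') 2), IsNewformOf W' f' ∧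
          ∃ n : ℕ, ‖PowerSeries.coeff n (padicLFunction f' (unitRoot W' p : ℚ_[p]))‖ = 1 := by
  intro W _ _ p _ hX hns
  obtain ⟨hp3, ⟨hgood, hord⟩, -, -⟩ := id hX
  subst hp3
  haveI : NeZero (W.conductorNorm ℤ) := ⟨(W.conductorNorm_pos_holds).ne'⟩
  obtain ⟨Dm⟩ := hmodP W
  refine ⟨W, ‹_›, ‹_›, hgood, hord, ⟨AddEquiv.refl _, fun σ P => rfl⟩, W.conductorNorm ℤ, ‹_›, Dm.f,
    Dm.isNewformOf, ?_⟩
  unfold PrintX10b.AnalyticMuZeroX10b AnalyticMuZeroOnClassX10b at hA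
  exact hA W 3 Dm.f hX hns Dm.isNewformOf

/-- **The congruence road at `3`, class-wide, is EXACTLY the crux.** Modulo EPW Thm. 1 at odd `p`
(`hEPW`), Mazur's odd Manin constant (`hM`), Carayol (`hlev`) and modularity (`hmodP`):
`Theses.PrintX10b.AnalyticMuZeroX10b ↔ «every X10b pair has a certified good-ordinary 3-congruent
partner»`. The road re-indexes Greenberg's analytic `μ = 0` at `3` on X10b by mod-`3` representation
(one certificate per `ρ̄`) and does not weaken it; the residual crux of the line `epw-partner` is
stmt-20682 itself. [cite: EmertonPollackWeston2006, Thm. 1 (arXiv:math/0404484 p. 2)]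
[cite: GreenbergLNM1716, §1 Conj. 1.11] [cite: Mazur1978, Cor. 4.1] -/
theorem printX10b_analyticMuZeroX10b_iff_forall_exists_certifiedPartner
    (hEPW : EmertonPollackWeston2006.thm1_muAn_transfer_of_torsionIso_odd)
    (hM : mazur_not_dvd_maninConstant_of_odd)
    (hlev : ∀ (N : ℕ) [NeZero N], IsNewformOf.level_eq_conductorNorm (N := N))
    (hmodP : nonempty_modularParametrizationData) :
    PrintX10b.AnalyticMuZeroX10b ↔
    ∀ (W : WeierstrassCurve ℚ) [W.IsElliptic] [W.IsGloballyMinimal] (p : ℕ) [Fact p.Prime],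
      ClassX10 W p → ¬ Surj W 3 →
      ∃ (W' : WeierstrassCurve ℚ) (_ : W'.IsElliptic) (_ : W'.IsGloballyMinimal),
        W'.HasGoodReductionAtPrime p ∧ ¬ (p : ℤ) ∣ W'.frobeniusTrace p ∧
        (∃ e : geomTorsion W' (p : ℤ) ≃+ geomTorsion W (p : ℤ),
          ∀ (σ : Field.absoluteGaloisGroup ℚ) (P : geomTorsion W' (p : ℤ)), e (σ • P) = σ • e P) ∧
        ∃ (N' : ℕ) (_ : NeZero N') (f' : CuspForm (Gamma0 N') 2), IsNewformOf W' f' ∧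
          ∃ n : ℕ, ‖PowerSeries.coeff n (padicLFunction f' (unitRoot W' p : ℚ_[p]))‖ = 1 :=
  ⟨printX10b_forall_exists_certifiedPartner_of_analyticMuZeroX10b hmodP,
    printX10b_analyticMuZeroX10b_of_forall_exists_certifiedPartner hEPW hM hlev⟩

/-- **The same with the print facts packaged as the route's items**: `MazurManinConstantOdd` (aside
19383) and `ModularParametrizationSupply` (aside 19266) of route PrintX10b, plus EPW (odd `p`) and
Carayol by name. A kernel display; not a route edit. [cite: EmertonPollackWeston2006, Thm. 1 (arXiv:math/0404484 p. 2)]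
[cite: Mazur1978, Cor. 4.1] [cite: GreenbergLNM1716, §1 Conj. 1.11] -/
theorem printX10b_analyticMuZeroX10b_iff_forall_exists_certifiedPartner_of_items
    (hEPW : EmertonPollackWeston2006.thm1_muAn_transfer_of_torsionIso_odd)
    (hM : PrintX10b.MazurManinConstantOdd)
    (hlev : ∀ (N : ℕ) [NeZero N], IsNewformOf.level_eq_conductorNorm (N := N))
    (hmodP : PrintX10b.ModularParametrizationSupply) :
    PrintX10b.AnalyticMuZeroX10b ↔
    ∀ (W : WeierstrassCurve ℚ) [W.IsElliptic] [W.IsGloballyMinimal] (p : ℕ) [Fact p.Prime],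
      ClassX10 W p → ¬ Surj W 3 →
      ∃ (W' : WeierstrassCurve ℚ) (_ : W'.IsElliptic) (_ : W'.IsGloballyMinimal),
        W'.HasGoodReductionAtPrime p ∧ ¬ (p : ℤ) ∣ W'.frobeniusTrace p ∧
        (∃ e : geomTorsion W' (p : ℤ) ≃+ geomTorsion W (p : ℤ),
          ∀ (σ : Field.absoluteGaloisGroup ℚ) (P : geomTorsion W' (p : ℤ)), e (σ • P) = σ • e P) ∧
        ∃ (N' : ℕ) (_ : NeZero N') (f' : CuspForm (Gamma0 N') 2), IsNewformOf W' f' ∧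
          ∃ n : ℕ, ‖PowerSeries.coeff n (padicLFunction f' (unitRoot W' p : ℚ_[p]))‖ = 1 :=
  printX10b_analyticMuZeroX10b_iff_forall_exists_certifiedPartner hEPW hM hlev hmodP

/-! ### §4 The birth skeleton's composition, with the skeleton's exact stub signatures -/

/-- **Line `epw-partner` composes in the kernel (Theorems-side copy of the skeleton's
`AnalyticMuZeroX10b_of`).** With the EXACT signatures of the registered stubs —
`h1 = stub_certifiedPartner` (every X10b pair has a `μ`-certified good-ordinary irreducible partner with
isomorphic mod-`p` representation; the open content) and `h2 = stub_transferPrint` (EPW odd ∧ period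
units ∧ Carayol; print, see `printX10b_transferPrint_of_mazur`) — the crux
`Theses.PrintX10b.AnalyticMuZeroX10b` follows (`X10.certificate_of_torsionIso_of_ne_two'`).
[cite: EmertonPollackWeston2006, Thm. 1 (arXiv:math/0404484 p. 2)] [cite: GreenbergVatsal2000, §3 Remark (3.4)] -/
theorem printX10b_analyticMuZeroX10b_of_stubs
    (h1 : ∀ (W : WeierstrassCurve ℚ) [W.IsElliptic] [W.IsGloballyMinimal] (p : ℕ) [Fact p.Prime],
      ClassX10 W p → ¬ Surj W 3 →
      ∃ (W' : WeierstrassCurve ℚ) (_ : W'.IsElliptic) (_ : W'.IsGloballyMinimal),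
        W'.HasGoodReductionAtPrime p ∧ ¬ (p : ℤ) ∣ W'.frobeniusTrace p ∧
        W'.HasIrreducibleModPGaloisRep p ∧
        (∃ e : geomTorsion W' (p : ℤ) ≃+ geomTorsion W (p : ℤ),
          ∀ (σ : Field.absoluteGaloisGroup ℚ) (P : geomTorsion W' (p : ℤ)), e (σ • P) = σ • e P) ∧
        ∃ (N' : ℕ) (_ : NeZero N') (f' : CuspForm (Gamma0 N') 2), IsNewformOf W' f' ∧
          ∃ n : ℕ, ‖PowerSeries.coeff n (padicLFunction f' (unitRoot W' p : ℚ_[p]))‖ = 1)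
    (h2 : EmertonPollackWeston2006.thm1_muAn_transfer_of_torsionIso_odd ∧
      realPeriodRat_eq_unit_mul_plusPeriod ∧ realPeriodRat_eq_unit_mul_plusPeriod_three ∧
      (∀ (N : ℕ) [NeZero N], IsNewformOf.level_eq_conductorNorm (N := N))) :
    PrintX10b.AnalyticMuZeroX10b := by
  intro W _ _ p _ N _ f hX hns hf
  obtain ⟨hEPW, h5, h3, hlev⟩ := h2
  obtain ⟨W', _, _, hgood', hord', hirr', hiso, N', _, f', hf', hcert'⟩ := h1 W p hX hns
  obtain ⟨hp3, ⟨hgood, hord⟩, -, -⟩ := hX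
  subst hp3
  exact certificate_of_torsionIso_of_ne_two' hEPW h5 h3 hlev W' W 3 (by decide) hgood' hord' hirr'
    hgood hord hiso f' hf' f hf hcert'

/-- **Line `epw-partner` modulo its ONE open stub.** Granting only `stub_certifiedPartner` (`h1`) and the
three cite-only heads `hEPW`, `hM`, `hlev`, the crux follows — the print stub being a theorem
(`printX10b_transferPrint_of_mazur`). So the line's residual content is exactly «every mod-`3`
representation of the class has a certifiable good-ordinary partner».
[cite: EmertonPollackWeston2006, Thm. 1 (arXiv:math/0404484 p. 2)] [cite: Mazur1978, Cor. 4.1] -/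
theorem printX10b_analyticMuZeroX10b_of_stub_certifiedPartner
    (h1 : ∀ (W : WeierstrassCurve ℚ) [W.IsElliptic] [W.IsGloballyMinimal] (p : ℕ) [Fact p.Prime],
      ClassX10 W p → ¬ Surj W 3 →
      ∃ (W' : WeierstrassCurve ℚ) (_ : W'.IsElliptic) (_ : W'.IsGloballyMinimal),
        W'.HasGoodReductionAtPrime p ∧ ¬ (p : ℤ) ∣ W'.frobeniusTrace p ∧
        W'.HasIrreducibleModPGaloisRep p ∧
        (∃ e : geomTorsion W' (p : ℤ) ≃+ geomTorsion W (p : ℤ),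
          ∀ (σ : Field.absoluteGaloisGroup ℚ) (P : geomTorsion W' (p : ℤ)), e (σ • P) = σ • e P) ∧
        ∃ (N' : ℕ) (_ : NeZero N') (f' : CuspForm (Gamma0 N') 2), IsNewformOf W' f' ∧
          ∃ n : ℕ, ‖PowerSeries.coeff n (padicLFunction f' (unitRoot W' p : ℚ_[p]))‖ = 1)
    (hEPW : EmertonPollackWeston2006.thm1_muAn_transfer_of_torsionIso_odd)
    (hM : mazur_not_dvd_maninConstant_of_odd)
    (hlev : ∀ (N : ℕ) [NeZero N], IsNewformOf.level_eq_conductorNorm (N := N)) :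
    PrintX10b.AnalyticMuZeroX10b :=
  printX10b_analyticMuZeroX10b_of_stubs h1 (printX10b_transferPrint_of_mazur hEPW hM hlev)

/-! ### §5 Carayol discharged: the equivalence and the line modulo EPW, Mazur and MODULARITY only
(appended p2 g2, after lit g6's cone note DOSSIER v7.3 §22.10) -/

/-- **The congruence road at `3`, class-wide, is EXACTLY crux 20682 — modulo THREE print heads only**:
Emerton–Pollack–Weston Thm. 1 at odd `p` (`hEPW`), Mazur 1978 Cor. 4.1 (`hM` = route aside 19383
`MazurManinConstantOdd`) and modularity as parametrisation data (`hmodP` = route aside 19266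
`ModularParametrizationSupply`; it also discharges Carayol: `IsNewformOf.level_eq_conductorNorm_of_exists_isNewformOf'`
∘ `exists_isNewformOf_of_nonempty_modularParametrizationData`, Atkin–Lehner Thm 4 / Diamond–Shurman 8.8.1 — the
named lemma `level_eq_conductorNorm_of_modularParametrizationData` lives in the PrintX9 twin, p553725, not imported here).
[cite: EmertonPollackWeston2006, Thm. 1 (arXiv:math/0404484 p. 2)] [cite: Mazur1978, Cor. 4.1]
[cite: BCDTJAMS2001, Thm. A] [cite: GreenbergLNM1716, §1 Conj. 1.11] -/
theorem printX10b_analyticMuZeroX10b_iff_forall_exists_certifiedPartner_of_asides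
    (hEPW : EmertonPollackWeston2006.thm1_muAn_transfer_of_torsionIso_odd)
    (hM : PrintX10b.MazurManinConstantOdd) (hmodP : PrintX10b.ModularParametrizationSupply) :
    PrintX10b.AnalyticMuZeroX10b ↔
    ∀ (W : WeierstrassCurve ℚ) [W.IsElliptic] [W.IsGloballyMinimal] (p : ℕ) [Fact p.Prime],
      ClassX10 W p → ¬ Surj W 3 →
      ∃ (W' : WeierstrassCurve ℚ) (_ : W'.IsElliptic) (_ : W'.IsGloballyMinimal),
        W'.HasGoodReductionAtPrime p ∧ ¬ (p : ℤ) ∣ W'.frobeniusTrace p ∧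
        (∃ e : geomTorsion W' (p : ℤ) ≃+ geomTorsion W (p : ℤ),
          ∀ (σ : Field.absoluteGaloisGroup ℚ) (P : geomTorsion W' (p : ℤ)), e (σ • P) = σ • e P) ∧
        ∃ (N' : ℕ) (_ : NeZero N') (f' : CuspForm (Gamma0 N') 2), IsNewformOf W' f' ∧
          ∃ n : ℕ, ‖PowerSeries.coeff n (padicLFunction f' (unitRoot W' p : ℚ_[p]))‖ = 1 :=
  printX10b_analyticMuZeroX10b_iff_forall_exists_certifiedPartner hEPW hM
    (fun _ _ => IsNewformOf.level_eq_conductorNorm_of_exists_isNewformOf'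
      (exists_isNewformOf_of_nonempty_modularParametrizationData hmodP)) hmodP

/-- **Line `epw-partner` modulo its ONE open stub and route asides only**: `stub_certifiedPartner` (`h1`)
+ EPW Thm. 1 odd (`hEPW`) + asides 19383 (`hM`) and 19266 (`hmodP`) ⟹ crux 20682. The print stub of
the skeleton is thereby discharged down to heads the route already item-states (plus EPW).
[cite: EmertonPollackWeston2006, Thm. 1 (arXiv:math/0404484 p. 2)] [cite: Mazur1978, Cor. 4.1]
[cite: BCDTJAMS2001, Thm. A] -/
theorem printX10b_analyticMuZeroX10b_of_stub_certifiedPartner_of_asides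
    (h1 : ∀ (W : WeierstrassCurve ℚ) [W.IsElliptic] [W.IsGloballyMinimal] (p : ℕ) [Fact p.Prime],
      ClassX10 W p → ¬ Surj W 3 →
      ∃ (W' : WeierstrassCurve ℚ) (_ : W'.IsElliptic) (_ : W'.IsGloballyMinimal),
        W'.HasGoodReductionAtPrime p ∧ ¬ (p : ℤ) ∣ W'.frobeniusTrace p ∧
        W'.HasIrreducibleModPGaloisRep p ∧
        (∃ e : geomTorsion W' (p : ℤ) ≃+ geomTorsion W (p : ℤ),
          ∀ (σ : Field.absoluteGaloisGroup ℚ) (P : geomTorsion W' (p : ℤ)), e (σ • P) = σ • e P) ∧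
        ∃ (N' : ℕ) (_ : NeZero N') (f' : CuspForm (Gamma0 N') 2), IsNewformOf W' f' ∧
          ∃ n : ℕ, ‖PowerSeries.coeff n (padicLFunction f' (unitRoot W' p : ℚ_[p]))‖ = 1)
    (hEPW : EmertonPollackWeston2006.thm1_muAn_transfer_of_torsionIso_odd)
    (hM : PrintX10b.MazurManinConstantOdd) (hmodP : PrintX10b.ModularParametrizationSupply) :
    PrintX10b.AnalyticMuZeroX10b :=
  printX10b_analyticMuZeroX10b_of_stub_certifiedPartner h1 hEPW hM
    (fun _ _ => IsNewformOf.level_eq_conductorNorm_of_exists_isNewformOf'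
      (exists_isNewformOf_of_nonempty_modularParametrizationData hmodP))

end Summit.BirchSwinnertonDyer.Rank1Residual.X10

end
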